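import Mathlib
import Literature.MathematicalPhysics.QuantumFieldTheory.SUNBakryEmeryPoincare
import Literature.Computability.QuantumComplexity.PolynomialMethod
import Summits.Ventures.LatticeQCDFlow.TrivializingMaps.SlotHilbert
import Summits.Ventures.LatticeQCDFlow.TrivializingMaps.SlotFunctions

/-!
# The spectral gap of the slot Casimirs, without representation theory (E7 of THEORY-1 §19, part 2)

HONEST FRAMING. Exact (Metropolis-corrected) sampling algorithms for lattice gauge theory; figures of
merit are autocorrelation/cost numbers at stated couplings and volumes; no continuum-physics claim.
This file is ONE use of the tree's Poincaré inequality on `SU(n)` plus linear algebra; no physics.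

For a slot system `(lnk, pol)` and a link `e`, the slot Casimir `C^{σ,e} = -∑ₐ T_a^{σ,e} T_a^{σ,e}`
(`SlotCasimir.casimirM`) has every eigenvalue equal to `0` or `≥ n/4` (`casimirM_gap`), **uniformly in
the slot system** — the constant `γ = n/4` of THEORY-1 §19.3 — with no Peter–Weyl theorem and no
highest weights:

* for an eigenvector `C^{σ,e} x = λ x` the coefficient functions `u_I = Re (R_σ x)_I`, `v_I = Im (R_σ x)_I`
  satisfy `Δ_tree u = -2λ u` (`SlotFunctions.Lap_slotFn_of_eigen`); so `∫ u dHaar = 0`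
  (`SUNBakryEmery.integral_Lap`), and the tree's Poincaré inequality `SUNBakryEmery.poincare_haar`
  (`(n/2)·Var ≤ ∫ Γ(u,u)`) with `∫ Γ(u,u) = -∫ u Δu = 2λ ∫ u²` (`SUNBakryEmery.integral_mul_Lap`) gives
  `(n/2 - 2λ) ∫ u² ≤ 0` (`sq_integral_nonpos_of_Lap_eq`);
* `∑_I (u_I² + v_I²) = ‖R_σ x‖² = ‖x‖²` pointwise on `SU(n)` (`R_σ` unitary), so integrating and summing,
  `(n/2 - 2λ)‖x‖² ≤ 0`: `λ ≥ n/4` unless `λ = 0`.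

`slotMode_gap` restates the result for the joint modes of `SlotHilbert.casimirFamily` (the form the
graded Lüscher series consumes).  [folklore (spectral gap of the Laplacian on `SU(n)` via Bakry–Émery);
ours: the representation-free route through coefficient functions]
-/

noncomputable section

namespace Summit.Ventures.LatticeQCDFlow.TrivializingMaps.SlotCasimirGap

open scoped ComplexConjugate Matrix Matrix.Norms.Frobenius ContDiff
open MeasureTheory Finset
open Literature.MathematicalPhysics.QuantumFieldTheory
open Literature.MathematicalPhysics.QuantumFieldTheory.Luscher2010
open Literature.MathematicalPhysics.QuantumFieldTheory.SUNBakryEmery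
open SlotRepresentation SlotCasimir SlotFunctions

variable {n : ℕ} {σ : Type*} [Fintype σ] [DecidableEq σ] {E : Type*} [DecidableEq E]


/-! ## 3. Poincaré ⇒ gap -/

section Gap

/-- From the tree's Poincaré inequality: a smooth `u` with `Δ_tree u = c u` pointwise, `c ≠ 0`, has
`∫ u = 0` and `(N/2 + c) ∫_{SU(N)} u² ≤ 0`. [folklore] -/
theorem sq_integral_nonpos_of_Lap_eq {N : ℕ} (hN : N ≠ 0) {u : Matrix (Fin N) (Fin N) ℂ → ℝ}
    (hu : ContDiff ℝ ∞ u) {c : ℝ} (hLap : ∀ Q, Lap u Q = c * u Q) (hc : c ≠ 0) :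
    ((N : ℝ) / 2 + c) * ∫ g : SUN N, u g ^ 2 ∂(haarSU N) ≤ 0 := by
  have hmean : ∫ g : SUN N, u g ∂(haarSU N) = 0 := by
    have h := integral_Lap hN hu
    simp_rw [hLap] at h
    rw [integral_const_mul] at h
    exact (mul_eq_zero.1 h).resolve_left hc
  have hP := poincare_haar hN hu
  simp only [hmean, sub_zero] at hP
  have hG : ∫ g : SUN N, Gam u u g ∂(haarSU N) = -(c * ∫ g : SUN N, u g ^ 2 ∂(haarSU N)) := by
    have h := integral_mul_Lap hN hu hu
    simp_rw [hLap] at h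
    have h' : ∫ g : SUN N, u g * (c * u g) ∂(haarSU N) = c * ∫ g : SUN N, u g ^ 2 ∂(haarSU N) := by
      rw [← integral_const_mul]
      exact integral_congr_ae (Filter.Eventually.of_forall fun g => by ring)
    linarith
  rw [hG] at hP
  linarith

variable (B : SuBasis n) (lnk : σ → E) (pol : σ → Bool)

/-- `Re² + Im² = ‖·‖²`, summed. [folklore] -/
theorem sum_re_sq_add_im_sq {m : Type*} [Fintype m] (z : m → ℂ) :
    ∑ i, ((z i).re ^ 2 + (z i).im ^ 2) = ∑ i, ‖z i‖ ^ 2 :=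
  sum_congr rfl fun i _ => by rw [Complex.sq_norm, Complex.normSq_apply]; ring

/-- **Spectral gap of the slot Casimir (E7)**: every eigenvalue of `C^{σ,e}` is `0` or `≥ n/4`,
uniformly in the slot system `(lnk, pol)` and the link `e`. [ours; folklore content] -/
theorem casimirM_gap [Fintype E] (hn : n ≠ 0) (e : E) {x : (σ → Fin n) → ℂ} (hx : x ≠ 0) {ev : ℝ}
    (hCx : casimirM B lnk pol e *ᵥ x = (ev : ℂ) • x) : ev = 0 ∨ (n : ℝ) / 4 ≤ ev := by
  classical
  by_cases hev : ev = 0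
  · exact Or.inl hev
  right
  set W₀ : E → Matrix (Fin n) (Fin n) ℂ := fun _ => 1 with hW₀
  -- real and imaginary parts of the components of `R_σ x` as coefficient functions
  set aI : (σ → Fin n) → Ker σ n := fun I => fun I' J => (-Complex.I) * rowKer I x I' J with haI
  set u : (σ → Fin n) → Matrix (Fin n) (Fin n) ℂ → ℝ := fun I => slotFn lnk pol (rowKer I x) W₀ e with hu
  set v : (σ → Fin n) → Matrix (Fin n) (Fin n) ℂ → ℝ := fun I => slotFn lnk pol (aI I) W₀ e with hv
  have hrow : ∀ I, contractR (rowKer I x) (casimirM B lnk pol e) = fun I' K => (ev : ℂ) * rowKer I x I' K := by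
    intro I
    rw [contractR_rowKer, hCx]
    funext I' K
    by_cases h : I' = I
    · simp only [rowKer, h, if_true, Pi.smul_apply, smul_eq_mul]
    · simp only [rowKer, h, if_false, mul_zero]
  have haIe : ∀ I, contractR (aI I) (casimirM B lnk pol e) = fun I' K => (ev : ℂ) * aI I I' K := by
    intro I
    rw [haI, contractR_smul_ker, hrow I]
    funext I' K
    ring
  have hc : (-2 * ev) ≠ 0 := mul_ne_zero (by norm_num) hev
  have hu_int : ∀ I, ((n : ℝ) / 2 + (-2 * ev)) * ∫ g : SUN n, u I g ^ 2 ∂(haarSU n) ≤ 0 := fun I =>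
    sq_integral_nonpos_of_Lap_eq hn (contDiff_slotFn lnk pol _ W₀ e)
      (Lap_slotFn_of_eigen lnk pol B hn (hrow I) W₀) hc
  have hv_int : ∀ I, ((n : ℝ) / 2 + (-2 * ev)) * ∫ g : SUN n, v I g ^ 2 ∂(haarSU n) ≤ 0 := fun I =>
    sq_integral_nonpos_of_Lap_eq hn (contDiff_slotFn lnk pol _ W₀ e)
      (Lap_slotFn_of_eigen lnk pol B hn (haIe I) W₀) hc
  -- pointwise: `∑_I (u_I² + v_I²) = ‖x‖²` on `SU(n)`
  have hpt : ∀ g : SUN n, ∑ I, (u I g ^ 2 + v I g ^ 2) = ∑ I, ‖x I‖ ^ 2 := by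
    intro g
    have hR : slotRep lnk pol (Function.update W₀ e (g : Matrix (Fin n) (Fin n) ℂ)) ∈
        Matrix.unitaryGroup (σ → Fin n) ℂ := by
      refine slotRep_mem_unitaryGroup lnk pol fun e' => ?_
      by_cases h : e' = e
      · subst h
        rw [Function.update_self]
        exact (Matrix.mem_specialUnitaryGroup_iff.1 g.prop).1
      · rw [Function.update_of_ne h, hW₀]
        exact Submonoid.one_mem _
    rw [← Literature.Computability.QuantumComplexity.sum_norm_sq_mulVec_of_mem_unitaryGroup hR x,
      ← sum_re_sq_add_im_sq]
    refine sum_congr rfl fun I _ => ?_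
    have h1 : u I g = ((slotRep lnk pol (Function.update W₀ e (g : Matrix (Fin n) (Fin n) ℂ)) *ᵥ x) I).re := by
      simp only [hu, slotFn, slotFnC_rowKer]
    have h2 : v I g = ((slotRep lnk pol (Function.update W₀ e (g : Matrix (Fin n) (Fin n) ℂ)) *ᵥ x) I).im := by
      simp only [hv, haI, slotFn]
      rw [slotFnC_smul_rowKer]
      simp [Complex.mul_re]
    rw [h1, h2]
  -- integrate and sum
  have hcont : ∀ I, Continuous fun g : SUN n => u I g ^ 2 + v I g ^ 2 := fun I =>
    ((continuous_restrict (contDiff_slotFn lnk pol _ W₀ e)).pow 2).add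
      ((continuous_restrict (contDiff_slotFn lnk pol _ W₀ e)).pow 2)
  have hsum : ∑ I, (∫ g : SUN n, u I g ^ 2 ∂(haarSU n) + ∫ g : SUN n, v I g ^ 2 ∂(haarSU n)) =
      ∑ I, ‖x I‖ ^ 2 := by
    have hsplit : ∀ I, ∫ g : SUN n, u I g ^ 2 ∂(haarSU n) + ∫ g : SUN n, v I g ^ 2 ∂(haarSU n) =
        ∫ g : SUN n, (u I g ^ 2 + v I g ^ 2) ∂(haarSU n) := fun I =>
      (integral_add (integrable_of_continuous_SUN ((continuous_restrict
          (contDiff_slotFn lnk pol _ W₀ e)).pow 2) _)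
        (integrable_of_continuous_SUN ((continuous_restrict (contDiff_slotFn lnk pol _ W₀ e)).pow 2) _)).symm
    simp_rw [hsplit]
    rw [← integral_finsetSum _ fun I _ => integrable_of_continuous_SUN (hcont I) _]
    simp_rw [hpt]
    rw [integral_const]
    simp
  have hX : 0 < ∑ I, ‖x I‖ ^ 2 := by
    obtain ⟨I₀, hI₀⟩ := Function.ne_iff.1 hx
    exact lt_of_lt_of_le (pow_pos (norm_pos_iff.2 hI₀) 2)
      (Finset.single_le_sum (fun I _ => sq_nonneg ‖x I‖) (Finset.mem_univ I₀))
  have hprod : ((n : ℝ) / 2 + (-2 * ev)) * ∑ I, ‖x I‖ ^ 2 ≤ 0 := by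
    rw [← hsum, Finset.mul_sum]
    exact Finset.sum_nonpos fun I _ => by
      rw [mul_add]; exact add_nonpos (hu_int I) (hv_int I)
  have hcoef : (n : ℝ) / 2 + (-2 * ev) ≤ 0 := by
    by_contra hlt
    exact absurd hprod (not_le.2 (mul_pos (lt_of_not_ge hlt) hX))
  linarith

open SlotHilbert CasimirGrading JointGrading in
/-- **(E7) for the joint modes**: every mode `m_e` of the slot Casimir family is `0` or `≥ n/4`. [ours] -/
theorem slotMode_gap [Fintype E] (hn : n ≠ 0) (m : Modes (casimirFamily lnk pol B)) (e : E) :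
    (m e : ℂ) = 0 ∨ (n : ℝ) / 4 ≤ (m e : ℂ).re := by
  obtain ⟨v, hv⟩ := Module.End.HasEigenvalue.exists_hasEigenvector
    (f := (casimirFamily lnk pol B e : SlotSpace σ n →ₗ[ℂ] SlotSpace σ n)) (m e).property
  have hre : (m e : ℂ) = (((m e : ℂ).re : ℝ) : ℂ) :=
    mode_eq_re _ (fun e' => isSelfAdjoint_casimirCLM lnk pol B e') m e
  have h1 : (casimirFamily lnk pol B e : SlotSpace σ n →ₗ[ℂ] SlotSpace σ n) v = (m e : ℂ) • v :=
    hv.apply_eq_smul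
  rw [ContinuousLinearMap.coe_coe] at h1
  set x : (σ → Fin n) → ℂ := WithLp.ofLp v with hx
  have hx0 : x ≠ 0 := fun h => hv.2 (by
    have : v = WithLp.toLp 2 x := by simp [hx]
    rw [this, h]; rfl)
  have hCx : casimirM B lnk pol e *ᵥ x = (((m e : ℂ).re : ℝ) : ℂ) • x := by
    have h2 := congrArg WithLp.ofLp h1
    rw [Matrix.ofLp_toEuclideanCLM, WithLp.ofLp_smul, hre] at h2
    exact h2
  rcases casimirM_gap B lnk pol hn e hx0 hCx with h | h
  · left; rw [hre, h]; simp
  · exact Or.inr h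

end Gap

end Summit.Ventures.LatticeQCDFlow.TrivializingMaps.SlotCasimirGap
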